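import Literature.NumberTheory.Automorphic.UnitaryLatticeTreeApartment   -- ★ `dualLatt_eq_self_of_isSelfDualLattice` (⇐), brings ★ `UnitaryLatticeTreeDual` (`dualLatt_latt`, `latt_mul_le_latt_iff`) and ★ `CartanUnique.v_det_le_one_of_forall_v_le_one`
import HarnessLib

/-!
# R90 · S6 «Ch. 14.1–14.5 stable trace formula» — WAVE 9 card W9-e₂: `Λ^{♯,H} = Λ` ⟺ `Λ` IS `H`-SELF-DUAL (`Theorems/R90S6DualFixedIffSelfDual.lean`)

DAG r5 row E1.4.3.1.2 «TWISTED POLARITY», last clause «`Fix(P_δ)` = the `h_δ`-self-dual lattices» (W9 sheet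
`R90/R90-C14-typ2/g2/S6_wave9_targets.v1.fcf093c820d92b07.lean` :124–:127 VERBATIM, ns without `.Wave9`): for a full-rank lattice `Λ = g·𝒪^N`
(`g ∈ GL_N(K)`), a non-degenerate form matrix `H`, `σ` valuation-preserving and `v ϖ ≤ 1`,
`Λ^{♯,H} = Λ ⟺ IsSelfDualLattice σ ϖ H Λ` (a type-`0` vertex: Gram matrix `G = ᵗ(σg) H g` integral with `ϖ G⁻¹` integral and `v (det G) = 1`).
(⇐) is ★ `dualLatt_eq_self_of_isSelfDualLattice hvσ hH`.  (⇒): `Λ^♯ = latt (g G⁻¹)` (★ `dualLatt_latt`), so `Λ^♯ = Λ` makes `G⁻¹` integral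
(★ `latt_mul_le_latt_iff` on `latt (g G⁻¹) ≤ latt g`) and `G` integral (same lemma on `latt ((g G⁻¹) G) ≤ latt (g G⁻¹)`), whence
`v (det G) ≤ 1`, `v (det G)⁻¹ ≤ 1` (★ `CartanUnique.v_det_le_one_of_forall_v_le_one`), `v (det G) = 1 = v(ϖ)^0`, and `ϖ G⁻¹` is integral as
`v ϖ ≤ 1` — the witness `g` for `IsVertexLattice σ ϖ H 0`.  With ★ W9-e₁ `mapGL_dualLatt_eq_dualLatt_mul_inv` (`Theorems/R90S6TwistedPolarity.lean`):
`Fix(P_δ)` on full-rank lattices = `{Λ : IsSelfDualLattice σ ϖ (J₀ δ⁻¹) Λ}` [Jacobowitz1962, §4; ShimuraIATAF1971, §3.1].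

Cell `hodgecm-mathlib`, crux H413 (`stmt-HodgeConjecture-24833`), route of record `HCCMUnconditional`; programme R90-TF (brief
`director/R90-BRIEF.v2.md` 1f40d54518340a35), section S6 (base `R90-C14`, dealer R90-C14-plan (g2)), seat R90-C14-p03 (g2); card W9-e₂ RE-DEALT BY NAME
2026-09-04T23:52:56Z.  Lane `--kind proof --supports stmt-HodgeConjecture-24833 --as helper`; ONE theorem over ★ Literature carriers (no definition, no
instance, no notation, no named fact, no kit, no `sorry`).
HONEST LABEL: lattice bookkeeping, count-neutral until E1.4.3.3.x consumes it; proves no printed global statement, discharges no citation; HC_CM is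
proved only modulo the 7 printed citations (2 remaining named inputs: hLiu418 = stmt-HodgeConjecture-24832, h413 = stmt-HodgeConjecture-24833) until rung 0 closes.

## References
* [Jacobowitz1962] R. Jacobowitz, *Hermitian forms over local fields*, Amer. J. Math. 84 (1962), §4 (dual lattices, unimodular lattices).
* [ShimuraIATAF1971] G. Shimura, *Introduction to the Arithmetic Theory of Automorphic Functions* (1971), §3.1 (lattices and their duals).
-/

set_option autoImplicit false
-- the mandated namespace repeats the single-problem summit's segment (`HodgeConjecture.HodgeConjecture`)
set_option linter.dupNamespace false

noncomputable section

open scoped Valued WithZero Matrix MatrixGroups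
open Literature.NumberTheory.Automorphic Literature.NumberTheory.Automorphic.HermitianLattice
  Literature.NumberTheory.Automorphic.UnitaryLatticeTree Literature.NumberTheory.Automorphic.CartanUnique

namespace Summit.HodgeConjecture.HodgeConjecture.R90.S6

variable {K : Type*} [Field K] [Valued K ℤᵐ⁰] {σ : K →+* K} {N : ℕ}

/-- **W9-e₂ (S) «`Λ^{♯,H} = Λ` ⟺ `Λ` is `H`-SELF-DUAL (a type-`0` vertex)» for a full-rank lattice `Λ = g·𝒪^N` and a non-degenerate `H`.**
(⇐) is ★ `dualLatt_eq_self_of_isSelfDualLattice hvσ hH`.  (⇒): with the Gram matrix `G = ᵗ(σg) H g` one has `Λ^♯ = latt (g G⁻¹)`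
(★ `dualLatt_latt`), so `Λ^♯ = Λ` gives `G⁻¹` and `G` integral (★ `latt_mul_le_latt_iff`, ★ `latt_le_latt_iff`), hence `v (det G) = 1`
and `ϖ G⁻¹` integral (`hϖ`) — the witness `g` for `IsVertexLattice σ ϖ H 0`.  With W9-e₁: `Fix(P_δ)` on full-rank lattices =
`{Λ : IsSelfDualLattice σ ϖ (J₀ δ⁻¹) Λ}` («`h_δ`-self-dual lattices», the row's last clause; `h_δ` is hermitian iff `N δ = δ Θ_σ δ = 1`).
★ at `N = 2` in `ValuativeRel` currency: `isSelfDualLattice_latt_iff`. [cite: Jacobowitz1962, §4] [cite: ShimuraIATAF1971, §3.1] -/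
theorem dualLatt_latt_eq_self_iff_isSelfDualLattice (hvσ : ∀ a, Valued.v (σ a) = Valued.v a) {ϖ : K} (hϖ : Valued.v ϖ ≤ 1)
    {H : Matrix (Fin N) (Fin N) K} (hH : IsUnit H.det) (g : GL (Fin N) K) :
    dualLatt σ H (latt ((g : GL (Fin N) K) : Matrix (Fin N) (Fin N) K)) = latt ((g : GL (Fin N) K) : Matrix (Fin N) (Fin N) K) ↔
      IsSelfDualLattice σ ϖ H (latt ((g : GL (Fin N) K) : Matrix (Fin N) (Fin N) K)) := by
  refine ⟨fun h => ?_, dualLatt_eq_self_of_isSelfDualLattice hvσ hH⟩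
  have hgu : IsUnit ((g : GL (Fin N) K) : Matrix (Fin N) (Fin N) K).det := Matrix.isUnits_det_units g
  -- the Gram matrix `G = ᵗ(σg) H g` is invertible
  set G : Matrix (Fin N) (Fin N) K := formCongr σ g H with hGdef
  have hGu : IsUnit G.det := by
    rw [hGdef, formCongr, Matrix.det_mul, Matrix.det_mul]
    exact ((isUnit_det_transpose_map σ hgu).mul hH).mul hgu
  have hGiu : IsUnit G⁻¹.det := Matrix.isUnit_nonsing_inv_det_iff.2 hGu
  -- `Λ^♯ = latt (g G⁻¹)`, so `Λ^♯ = Λ` forces `G⁻¹` and `G` to be integral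
  rw [dualLatt_latt σ hvσ hH g] at h
  have hGinv : IsIntMatrix G⁻¹ := (latt_mul_le_latt_iff hgu _).1 h.le
  have hgGu : IsUnit (((g : GL (Fin N) K) : Matrix (Fin N) (Fin N) K) * G⁻¹).det := by
    rw [Matrix.det_mul]; exact hgu.mul hGiu
  have hGint : IsIntMatrix G := by
    refine (latt_mul_le_latt_iff hgGu G).1 ?_
    rw [Matrix.mul_assoc, Matrix.nonsing_inv_mul _ hGu, Matrix.mul_one]
    exact h.ge
  -- `v (det G) = 1`
  have hvG : Valued.v G.det = 1 := by
    have h1 : Valued.v G.det ≤ 1 := v_det_le_one_of_forall_v_le_one hGint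
    have h2 : Valued.v G⁻¹.det ≤ 1 := v_det_le_one_of_forall_v_le_one hGinv
    rw [Matrix.det_nonsing_inv, Ring.inverse_eq_inv', map_inv₀] at h2
    have hne : Valued.v G.det ≠ 0 := (Valuation.ne_zero_iff _).2 hGu.ne_zero
    exact le_antisymm h1 (by rwa [inv_le_one₀ (zero_lt_iff.2 hne)] at h2)
  -- the witness
  refine ⟨g, rfl, hGint, fun i j => ?_, by rw [hvG, pow_zero]⟩
  rw [Matrix.smul_apply, smul_eq_mul, map_mul]
  exact mul_le_one' hϖ (hGinv i j)

end Summit.HodgeConjecture.HodgeConjecture.R90.S6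

end
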